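import Summits.BirchSwinnertonDyer.Rank1Residual.X9.PrintCertTamagawaCertifiedX9Ns
import Summits.BirchSwinnertonDyer.Rank1Residual.X9.PrintCertTamagawaCertifiedX9S4R0
import Summits.BirchSwinnertonDyer.Rank1Residual.X9.PrintCertTamagawaCertifiedX9S4R1
import Summits.BirchSwinnertonDyer.Rank1Residual.X9.PrintCertTamagawaCertifiedX10b
import HarnessLib

/-!
# Leaves X9 / X10b — KERNEL CENSUS of the Tamagawa depth of crux J over ALL certificate records (one-stop file)

HONEST FRAMING (cell `bsd-print-x9`, D-0131 (2) print tier): theorems about the cell's 1103 DATA records (the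
census of the partition leaves `ClassX9` — 790 Cremona pairs at `N < 5·10⁵`, `p ∈ {5, 7}` — and `ClassX10 ∧ ¬Surj` —
313 pairs at `p = 3`), evaluated IN THE KERNEL; no named fact; nothing asserted about any elliptic curve beyond the
per-record Tamagawa identities of `X9/PrintCertTamagawaCertified*.lean`; no pair is booked; no leaf is closed
(`BSDpOnClassX9`, `BSDpOnClassX10b` stay `@[conjecture]`). The census is a statement about THESE records, not
about the leaves (which are infinite classes).

* `allX9` / `allX10b`: the concatenation of the 10 + 4 record display lists (plumbing).
* `exists_tamCheck_of_mem_allX9 / _allX10b`: every record has a Tamagawa row certificate passing IN THE KERNEL,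
  hence `tamagawaProduct_of_mem_allX9 / _allX10b : ∏_ℓ c_ℓ(W) = r.tamagawa` for any globally minimal `W` with the
  record's integral model.
* `regime_allX9`: 790 records = 627 J-VACUOUS (`p ∤ ∏ c_ℓ`) + 158 SINGLE-CARRIER (Jetchev's regime, `stub_jetchevX9`)
  + 5 MULTI-PRIME (`stub_multiPrime`); crux J of route `PrintX9` (item 20392) is load-bearing in p4's kernel only at
  analytic rank `1` with `p ∣ ∏ c_ℓ` (`htam0` of `X9.bsdp_of_x9IntegralMainConjecture_of_heegnerRoad`): 96 records
  (92 single-carrier + the 4 multi-prime `6897c1`, `25773p1`, `25773q1`, `126687c1`, all at `p = 5`); on the other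
  694 the door `Record.pPartBSD_of_check_of_tamCheck` (`X9/PrintCertTamagawaDoors.lean`) needs NO J.
* `regime_allX10b`: 313 = 160 + 92 + 61; all 39 rank-`1` X10b records are multi-prime at `p = 3`.

References: [Silverman1994] IV.9.4 (Tate's algorithm); [Jetchev2008] Thm. 1.1; [CremonaAlgorithms1997] Table 1.
-/

set_option autoImplicit false

namespace Summit.BirchSwinnertonDyer.Rank1Residual.X9.PrintCert

open WeierstrassCurve

/-- All 790 X9 certificate records (slices `Ns5A`, `Ns5B`, `Ns7`, `S4R0A`–`C`, `S4R1A`–`D`, in this order). [folklore] -/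
def allX9 : List Record :=
  recordsNs5A ++ recordsNs5B ++ recordsNs7 ++ recordsS4R0A ++ recordsS4R0B ++ recordsS4R0C ++ recordsS4R1A ++
    recordsS4R1B ++ recordsS4R1C ++ recordsS4R1D

/-- All 313 X10b certificate records (slices `X10bNn`, `X10bNsR0A`, `X10bNsR0B`, `X10bNsR1`, in this order). [folklore] -/
def allX10b : List Record := recordsX10bNn ++ recordsX10bNsR0A ++ recordsX10bNsR0B ++ recordsX10bNsR1

-- kernel evaluation over 1103 records
set_option maxRecDepth 100000

/-- The lists have 790 and 313 entries (kernel count). [folklore] -/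
theorem length_allX9_allX10b : allX9.length = 790 ∧ allX10b.length = 313 := by
  constructor <;> decide +kernel

/-- **Every X9 record has a Tamagawa row certificate passing in the kernel.** [cite: Silverman1994, IV.9.4] -/
theorem exists_tamCheck_of_mem_allX9 {r : Record} (hr : r ∈ allX9) : ∃ c : TamCert, r.tamCheck c = true := by
  simp only [allX9, List.mem_append] at hr
  rcases hr with ((((((((h | h) | h) | h) | h) | h) | h) | h) | h) | h
  · obtain ⟨c, -, hc⟩ := exists_tamCheck_of_mem_Ns5A h; exact ⟨c, hc⟩
  · obtain ⟨c, -, hc⟩ := exists_tamCheck_of_mem_Ns5B h; exact ⟨c, hc⟩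
  · obtain ⟨c, -, hc⟩ := exists_tamCheck_of_mem_Ns7 h; exact ⟨c, hc⟩
  · obtain ⟨c, -, hc⟩ := exists_tamCheck_of_mem_S4R0A h; exact ⟨c, hc⟩
  · obtain ⟨c, -, hc⟩ := exists_tamCheck_of_mem_S4R0B h; exact ⟨c, hc⟩
  · obtain ⟨c, -, hc⟩ := exists_tamCheck_of_mem_S4R0C h; exact ⟨c, hc⟩
  · obtain ⟨c, -, hc⟩ := exists_tamCheck_of_mem_S4R1A h; exact ⟨c, hc⟩
  · obtain ⟨c, -, hc⟩ := exists_tamCheck_of_mem_S4R1B h; exact ⟨c, hc⟩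
  · obtain ⟨c, -, hc⟩ := exists_tamCheck_of_mem_S4R1C h; exact ⟨c, hc⟩
  · obtain ⟨c, -, hc⟩ := exists_tamCheck_of_mem_S4R1D h; exact ⟨c, hc⟩

/-- **Every X10b record has a Tamagawa row certificate passing in the kernel.** [cite: Silverman1994, IV.9.4] -/
theorem exists_tamCheck_of_mem_allX10b {r : Record} (hr : r ∈ allX10b) : ∃ c : TamCert, r.tamCheck c = true := by
  simp only [allX10b, List.mem_append] at hr
  rcases hr with ((h | h) | h) | h
  · obtain ⟨c, -, hc⟩ := exists_tamCheck_of_mem_X10bNn h; exact ⟨c, hc⟩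
  · obtain ⟨c, -, hc⟩ := exists_tamCheck_of_mem_X10bNsR0A h; exact ⟨c, hc⟩
  · obtain ⟨c, -, hc⟩ := exists_tamCheck_of_mem_X10bNsR0B h; exact ⟨c, hc⟩
  · obtain ⟨c, -, hc⟩ := exists_tamCheck_of_mem_X10bNsR1 h; exact ⟨c, hc⟩

/-- **`∏_ℓ c_ℓ(W) = r.tamagawa` IN THE KERNEL for every X9 record** and any globally minimal `W / ℚ` with the record's
integral model. [cite: Silverman1994, IV.9.4] [cite: CremonaAlgorithms1997, Table 1] -/
theorem tamagawaProduct_of_mem_allX9 {r : Record} (hr : r ∈ allX9) {W : WeierstrassCurve ℚ} [W.IsGloballyMinimal]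
    (hI : integralModelInt W = r.intCurve) : W.tamagawaProduct = r.tamagawa := by
  obtain ⟨c, hc⟩ := exists_tamCheck_of_mem_allX9 hr
  exact Record.tamagawaProduct_eq_of_tamCheck hI hc

/-- **`∏_ℓ c_ℓ(W) = r.tamagawa` IN THE KERNEL for every X10b record** and any globally minimal `W / ℚ` with the
record's integral model. [cite: Silverman1994, IV.9.4] [cite: CremonaAlgorithms1997, Table 1] -/
theorem tamagawaProduct_of_mem_allX10b {r : Record} (hr : r ∈ allX10b) {W : WeierstrassCurve ℚ} [W.IsGloballyMinimal]
    (hI : integralModelInt W = r.intCurve) : W.tamagawaProduct = r.tamagawa := by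
  obtain ⟨c, hc⟩ := exists_tamCheck_of_mem_allX10b hr
  exact Record.tamagawaProduct_eq_of_tamCheck hI hc

/-- **KERNEL CENSUS of the X9 records by the regime of crux J**: 627 J-vacuous (`p ∤ tamagawa`), 158 single-carrier,
5 multi-prime; by the analytic-rank CLAIM of the records: 67 rank-`0` and 96 rank-`1` records have `p ∣ tamagawa` —
J is load-bearing (p4's `htam0 : r_an = 1 → p ∤ ∏ c_ℓ`) on exactly those 96; the multi-prime records by label.
[folklore] -/
theorem regime_allX9 :
    (allX9.filter fun r => !decide (r.p ∣ r.tamagawa)).length = 627 ∧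
    (allX9.filter fun r => r.singleCarrier.isSome).length = 158 ∧
    (allX9.filter fun r => decide (r.p ∣ r.tamagawa) && r.singleCarrier.isNone).length = 5 ∧
    (allX9.filter fun r => decide (r.rank = 0 ∧ r.p ∣ r.tamagawa)).length = 67 ∧
    (allX9.filter fun r => decide (r.rank = 1 ∧ r.p ∣ r.tamagawa)).length = 96 ∧
    ((allX9.filter fun r => decide (r.p ∣ r.tamagawa) && r.singleCarrier.isNone).map fun r => (r.label, r.rank)) =
      [("6897c1", 1), ("25773p1", 1), ("25773q1", 1), ("126687c1", 1), ("56316n1", 0)] := by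
  refine ⟨?_, ?_, ?_, ?_, ?_, ?_⟩ <;> decide +kernel

/-- **KERNEL CENSUS of the X10b records by Tamagawa regime at `p = 3`**: 160 with `3 ∤ tamagawa`, 92 single-carrier,
61 multi-prime; 114 rank-`0` and 39 rank-`1` records have `3 ∣ tamagawa` (all 39 rank-`1` records, each multi-prime).
[folklore] -/
theorem regime_allX10b :
    (allX10b.filter fun r => !decide (r.p ∣ r.tamagawa)).length = 160 ∧
    (allX10b.filter fun r => r.singleCarrier.isSome).length = 92 ∧
    (allX10b.filter fun r => decide (r.p ∣ r.tamagawa) && r.singleCarrier.isNone).length = 61 ∧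
    (allX10b.filter fun r => decide (r.rank = 0 ∧ r.p ∣ r.tamagawa)).length = 114 ∧
    (allX10b.filter fun r => decide (r.rank = 1 ∧ r.p ∣ r.tamagawa)).length = 39 ∧
    (allX10b.filter fun r => decide (r.rank = 1)).length = 39 := by
  refine ⟨?_, ?_, ?_, ?_, ?_, ?_⟩ <;> decide +kernel

end Summit.BirchSwinnertonDyer.Rank1Residual.X9.PrintCert
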